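import Summits.ValiantsHypothesis.ValiantsHypothesis.Theses.ScaledPencil
import Summits.ValiantsHypothesis.ValiantsHypothesis.Theorems.HubHub
import Literature.Computability.AlgebraicComplexity.ValiantClasses
import Literature.Computability.AlgebraicComplexity.ValiantConjectureProofs
import Literature.Computability.AlgebraicComplexity.VPDeterminantalQPProofs
import Literature.Computability.AlgebraicComplexity.DeterminantalComplexityProofs

/-!
# Route ScaledPencil — `Assembly`

Closes item stmt-ValiantsHypothesis-5324 (`Assembly`, rank 1) of route
`route-ValiantsHypothesis-ScaledPencil`: the bookkeeping implication

  `NormalForm → ScaledPencilNoQP → ValiantsHypothesis`.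

Pure glue over PROVED tree results, no named-fact hypothesis:

* the NfToDc glue `NormalForm → ScaledPencilNoQP → DcPerNotQP` (the determinantal complexity
  `dc(per_n)` over `ℂ` is not quasi-polynomially bounded), inlined here with the same argument as
  `Summit.ValiantsHypothesis.ScaledPencil.nfToDc_proof` (Theorems/ScaledPencilNfToDc.lean, item
  stmt-ValiantsHypothesis-5323): `dc` is attained
  (`Literature.Computability.AlgebraicComplexity.hasDetRepr_determinantalComplexity_holds`), so a
  quasi-polynomial bound at `c` would give, through `NormalForm`, a normal-form pencil of size
  `m' ≤ dc(per_{n₀}) ≤ 2 ^ ((log₂ n₀ + c) ^ c)` at `n₀ := n₀(c)`, against `ScaledPencilNoQP`;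
* `Literature.Computability.AlgebraicComplexity.isQPBounded_determinantalComplexity_of_isVPFamily_holds`
  (a `VP` family has quasi-polynomially bounded determinantal complexity; Bürgisser–Clausen–
  Shokrollahi 1997, Cor. (21.40)), so the permanent family is not a `VP` family;
* the hub lemma `Summit.ValiantsHypothesis.Hub.valiantsHypothesis_of_not_isVPFamily_per`
  (Theorems/HubHub.lean) together with the renaming bridge
  `Literature.Computability.AlgebraicComplexity.mem_VP_ofFintype_iff_holds`
  (Bürgisser 2000, Rem. 2.2) and Valiant's theorem
  `Literature.Computability.AlgebraicComplexity.perFamily_mem_VNP_holds ℂ` (`per ∈ VNP`;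
  Valiant 1979, Bürgisser 2000, Thm. 2.10) give `VP ℂ ≠ VNP ℂ`.
-/

namespace Summit.ValiantsHypothesis.ScaledPencil

open Summit.ValiantsHypothesis.ValiantsHypothesis.Theses.ScaledPencil
open Literature.Computability.AlgebraicComplexity

/-- **Assembly** of route ScaledPencil (closes item stmt-ValiantsHypothesis-5324):
`NormalForm → ScaledPencilNoQP → ValiantsHypothesis`. The normal-form theorem and the target give
`DcPerNotQP` (the NfToDc glue, via `hasDetRepr_determinantalComplexity_holds`); if `(per_n)_n`
were a `VP` family over `ℂ` its determinantal complexity would be quasi-polynomially bounded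
(BCS 1997, Cor. (21.40)), a contradiction; so `per ∉ VP`, and with `per ∈ VNP` (Valiant 1979)
and the `ofFintype` renaming bridge the hub lemma `valiantsHypothesis_of_not_isVPFamily_per`
yields `VP ℂ ≠ VNP ℂ`. [folklore] -/
theorem assembly_proof :
    Summit.ValiantsHypothesis.ValiantsHypothesis.Theses.ScaledPencil.Assembly := by
  unfold Assembly
  intro hNF hX
  -- `DcPerNotQP` from `NormalForm` + `ScaledPencilNoQP` (the NfToDc glue, inlined)
  have hdc : DcPerNotQP := by
    unfold DcPerNotQP
    rintro ⟨c, hc⟩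
    obtain ⟨n₀, hn₀⟩ := hX c
    obtain ⟨m', hm', Λ, L, hdet, hscaled, hstable⟩ :=
      hNF n₀ _ (hasDetRepr_determinantalComplexity_holds (perPoly (Fin n₀) ℂ))
    have hlt : 2 ^ ((Nat.log 2 n₀ + c) ^ c) < m' := hn₀ n₀ le_rfl m' Λ L hdet hscaled hstable
    have hle : determinantalComplexity (perPoly (Fin n₀) ℂ) ≤ 2 ^ ((Nat.log 2 n₀ + c) ^ c) :=
      hc n₀
    omega
  refine Summit.ValiantsHypothesis.Hub.valiantsHypothesis_of_not_isVPFamily_per ?_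
    (mem_VP_ofFintype_iff_holds _) (perFamily_mem_VNP_holds ℂ)
  intro hVP
  exact hdc (isQPBounded_determinantalComplexity_of_isVPFamily_holds
    (fun n => perPoly (Fin n) ℂ) hVP)

end Summit.ValiantsHypothesis.ScaledPencil
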